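import Mathlib.Topology.Instances.AddCircle.Defs
import Literature.AnabelianGeometry.EtaleTheta.Cyclotome
import HarnessLib

/-!
# `Hom(ℚ/ℤ, A) ≅ Λ(A)`: the cyclotome as homomorphisms out of `ℚ/ℤ`

[AbsTopIII] (S. Mochizuki, *Topics in absolute anabelian geometry III*) DEFINES its cyclotomes through
`Hom(ℚ/ℤ, −)`: Def. 3.1 (v) p. 69 / Cor. 1.10 (i)(a) p. 41 «`μ_Ẑ(G_k) := Hom(ℚ/ℤ, μ_{ℚ/ℤ}(G_k))`»,
Prop. 3.2 (i) p. 71 l.57 «applying the functor `Hom(ℚ/ℤ, −)`»; the tree REALISES them by the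
inverse-limit cyclotome `Λ(A) = lim_n A[n]` of `Cyclotome.lean` (`EtaleTheta.cyclotome`, [LANA2026Report]
§6.1 p. 31) — e.g. `AbsoluteAnabelian.muZhat G := cyclotome (Multiplicative (muQZ G))`, whose docstring
says «realised — up to the canonical isomorphism `Hom(ℚ/ℤ, A) ≅ lim_n A[n]`».  This file supplies that
canonical isomorphism, for every commutative group `A` (`ℚ/ℤ = AddCircle (1 : ℚ)`, read multiplicatively):

* `cyclotome.ofHom : (ℚ/ℤ →* A) →* Λ(A)`, `φ ↦ (φ(1/n))_n` — a homomorphism out of `ℚ/ℤ` is a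
  compatible family of torsion elements;
* `cyclotome.ofHom_injective`, `cyclotome.ofHom_surjective` (the `n`-torsion of `ℚ/ℤ` is cyclic,
  generated by `1/n`: Mathlib `AddCircle.nsmul_eq_zero_iff`), whence
* `cyclotome.homQmodZEquiv : (ℚ/ℤ →* A) ≃* Λ(A)`, with `homQmodZEquiv_apply_coe`;
* naturality `ofHom_comp` (`Λ(ψ) ∘ ofHom = ofHom ∘ (ψ ∘ −)`) and equivariance `ofHom_smul` for a group
  acting on `A` by automorphisms (so `Hom(ℚ/ℤ, μ_{ℚ/ℤ}(G)) ≅ μ_Ẑ(G)` of [AbsTopIII] Cor. 1.10 (a) is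
  `homQmodZEquiv` at `A := Multiplicative (muQZ G)`, `G`-equivariantly).

Elementary and classical; proof-only apart from the maps themselves. HONEST FRAMING: nothing here
bears on [IUTchIII] Cor. 3.12; no side taken.
-/

namespace Literature.AnabelianGeometry.EtaleTheta

namespace cyclotome

open Function

universe u

variable {A : Type u} [CommGroup A]

/-! ### Torsion in `ℚ/ℤ`, multiplicatively -/

/-- `(1/n)^n = 1` in `ℚ/ℤ` (multiplicative notation). [cite: MochizukiAbsTopIII2015, Definition 3.1 (v) p.69] -/
theorem ofAdd_inv_pow_eq_one (n : ℕ+) :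
    (Multiplicative.ofAdd ((((1 : ℚ) / (n : ℕ) : ℚ) : AddCircle (1 : ℚ)))) ^ (n : ℕ) = 1 := by
  have h : (n : ℕ) • ((((1 : ℚ) / (n : ℕ) : ℚ) : AddCircle (1 : ℚ))) = 0 :=
    addOrderOf_dvd_iff_nsmul_eq_zero.1 (dvd_of_eq (AddCircle.addOrderOf_period_div n.pos))
  rw [← ofAdd_nsmul, h, ofAdd_zero]

/-- `(1/(n m))^m = 1/n` in `ℚ/ℤ` (multiplicative notation). [cite: MochizukiAbsTopIII2015, Definition 3.1 (v) p.69] -/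
theorem ofAdd_inv_mul_pow (n m : ℕ+) :
    (Multiplicative.ofAdd ((((1 : ℚ) / ((n * m : ℕ+) : ℕ) : ℚ) : AddCircle (1 : ℚ)))) ^ (m : ℕ) =
      Multiplicative.ofAdd ((((1 : ℚ) / (n : ℕ) : ℚ) : AddCircle (1 : ℚ))) := by
  rw [← ofAdd_nsmul, ← AddCircle.coe_nsmul, nsmul_eq_mul, PNat.mul_coe, Nat.cast_mul]
  congr 2
  have hn : ((n : ℕ) : ℚ) ≠ 0 := Nat.cast_ne_zero.2 n.ne_zero
  have hm : ((m : ℕ) : ℚ) ≠ 0 := Nat.cast_ne_zero.2 m.ne_zero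
  field_simp

/-- Every element of `ℚ/ℤ` (multiplicative notation) has finite positive order (the order of the
class of `q ∈ ℚ` is the denominator of `q`; cf. `ZHatCompletion.addOrderOf_pos_addCircle` for the
additive form). [cite: MochizukiAbsTopIII2015, Definition 3.1 (v) p.69] -/
theorem orderOf_pos_addCircle (u : Multiplicative (AddCircle (1 : ℚ))) : 0 < orderOf u := by
  rw [← ofAdd_toAdd u, orderOf_ofAdd_eq_addOrderOf]
  generalize Multiplicative.toAdd u = a
  induction a using QuotientAddGroup.induction_on with
  | H q =>
    have h := AddCircle.addOrderOf_coe_rat (p := (1 : ℚ)) (q := q)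
    rw [Rat.cast_id, mul_one] at h
    change 0 < addOrderOf ((q : ℚ) : AddCircle (1 : ℚ))
    rw [h]
    exact q.pos

/-- The order of `u ∈ ℚ/ℤ` as a positive natural number. [cite: MochizukiAbsTopIII2015, Definition 3.1 (v) p.69] -/
noncomputable def ordPNat (u : Multiplicative (AddCircle (1 : ℚ))) : ℕ+ := ⟨orderOf u, orderOf_pos_addCircle u⟩

/-- `u ^ (order of u) = 1`. [cite: MochizukiAbsTopIII2015, Definition 3.1 (v) p.69] -/
theorem pow_ordPNat (u : Multiplicative (AddCircle (1 : ℚ))) : u ^ (ordPNat u : ℕ) = 1 :=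
  pow_orderOf_eq_one u

/-- The `n`-torsion of `ℚ/ℤ` is generated by `1/n` (multiplicative notation): if `u^n = 1` then
`u = (1/n)^m` for some `m`. [cite: MochizukiAbsTopIII2015, Definition 3.1 (v) p.69] -/
theorem exists_eq_ofAdd_inv_pow (n : ℕ+) {u : Multiplicative (AddCircle (1 : ℚ))}
    (hu : u ^ (n : ℕ) = 1) :
    ∃ m : ℕ, u = (Multiplicative.ofAdd ((((1 : ℚ) / (n : ℕ) : ℚ) : AddCircle (1 : ℚ)))) ^ m := by
  have hu' : (n : ℕ) • Multiplicative.toAdd u = 0 := by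
    rw [← toAdd_pow, hu, toAdd_one]
  obtain ⟨m, -, hm⟩ := (AddCircle.nsmul_eq_zero_iff n.pos).1 hu'
  refine ⟨m, ?_⟩
  rw [← ofAdd_nsmul, ← AddCircle.natCast_div_mul_eq_nsmul, hm, ofAdd_toAdd]

/-! ### `Hom(ℚ/ℤ, A) → Λ(A)` -/

/-- **`Hom(ℚ/ℤ, A) → Λ(A)`**, `φ ↦ (φ(1/n))_n`: a homomorphism out of `ℚ/ℤ` yields a compatible family
of torsion elements. [cite: MochizukiAbsTopIII2015, Definition 3.1 (v) p.69] -/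
def ofHom : (Multiplicative (AddCircle (1 : ℚ)) →* A) →* cyclotome A where
  toFun φ := ⟨fun n => φ (Multiplicative.ofAdd ((((1 : ℚ) / (n : ℕ) : ℚ) : AddCircle (1 : ℚ)))),
    ⟨fun n => by rw [← map_pow, ofAdd_inv_pow_eq_one, map_one],
      fun n m => by rw [← map_pow, ofAdd_inv_mul_pow]⟩⟩
  map_one' := Subtype.ext (funext fun _ => rfl)
  map_mul' _ _ := Subtype.ext (funext fun _ => rfl)

/-- Components of `ofHom φ`. [cite: MochizukiAbsTopIII2015, Definition 3.1 (v) p.69] -/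
@[simp] theorem ofHom_apply_coe (φ : Multiplicative (AddCircle (1 : ℚ)) →* A) (n : ℕ+) :
    ((ofHom φ : cyclotome A) : ℕ+ → A) n =
      φ (Multiplicative.ofAdd ((((1 : ℚ) / (n : ℕ) : ℚ) : AddCircle (1 : ℚ)))) := rfl

/-- A homomorphism out of `ℚ/ℤ` is determined by its values on the `1/n`: `ofHom` is injective.
[cite: MochizukiAbsTopIII2015, Definition 3.1 (v) p.69] -/
theorem ofHom_injective : Injective (ofHom (A := A)) := by
  intro φ ψ h
  refine MonoidHom.ext fun u => ?_
  obtain ⟨m, hm⟩ := exists_eq_ofAdd_inv_pow (ordPNat u) (pow_ordPNat u)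
  have hcomp := congrArg (fun ζ : cyclotome A => (ζ : ℕ+ → A) (ordPNat u)) h
  simp only [ofHom_apply_coe] at hcomp
  rw [hm, map_pow, map_pow, hcomp]

/-! ### `Λ(A) → Hom(ℚ/ℤ, A)` -/

/-- The value of the homomorphism attached to `ζ ∈ Λ(A)` at `u ∈ ℚ/ℤ`: `ζ_n ^ m` for `u = (1/n)^m`,
`n` the order of `u` (choices; independence in `liftFun_eq`). [cite: MochizukiAbsTopIII2015, Definition 3.1 (v) p.69] -/
noncomputable def liftFun (ζ : cyclotome A) (u : Multiplicative (AddCircle (1 : ℚ))) : A :=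
  (ζ : ℕ+ → A) (ordPNat u) ^ (exists_eq_ofAdd_inv_pow (ordPNat u) (pow_ordPNat u)).choose

/-- Well-definedness at a fixed level: `(1/N)^m = (1/N)^m'` in `ℚ/ℤ` forces `N ∣ m - m'`, hence
`ζ_N ^ m = ζ_N ^ m'` (as `ζ_N ^ N = 1`). [cite: MochizukiAbsTopIII2015, Definition 3.1 (v) p.69] -/
theorem pow_eq_pow_of_ofAdd_inv_pow_eq (ζ : cyclotome A) (N : ℕ+) {m m' : ℕ}
    (h : (Multiplicative.ofAdd ((((1 : ℚ) / (N : ℕ) : ℚ) : AddCircle (1 : ℚ)))) ^ m =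
      (Multiplicative.ofAdd ((((1 : ℚ) / (N : ℕ) : ℚ) : AddCircle (1 : ℚ)))) ^ m') :
    (ζ : ℕ+ → A) N ^ m = (ζ : ℕ+ → A) N ^ m' := by
  -- the order of `1/N` is `N`, so `N ∣ m - m'` (as integers); and `ζ_N ^ N = 1`
  have hord : addOrderOf ((((1 : ℚ) / (N : ℕ) : ℚ) : AddCircle (1 : ℚ))) = N :=
    AddCircle.addOrderOf_period_div N.pos
  have h' : ((m : ℤ) - m') • ((((1 : ℚ) / (N : ℕ) : ℚ) : AddCircle (1 : ℚ))) = 0 := by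
    rw [sub_smul, natCast_zsmul, natCast_zsmul, sub_eq_zero]
    have := congrArg Multiplicative.toAdd h
    rwa [toAdd_pow, toAdd_pow, toAdd_ofAdd] at this
  have hdvd : ((N : ℕ) : ℤ) ∣ (m : ℤ) - m' := by
    rw [← hord]; exact addOrderOf_dvd_iff_zsmul_eq_zero.2 h'
  have hζ : orderOf ((ζ : ℕ+ → A) N) ∣ (N : ℕ) := orderOf_dvd_of_pow_eq_one (pow_eq_one ζ N)
  have h3 : ((orderOf ((ζ : ℕ+ → A) N) : ℕ) : ℤ) ∣ (m' : ℤ) - m :=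
    dvd_sub_comm.1 ((Int.natCast_dvd_natCast.2 hζ).trans hdvd)
  rw [← zpow_natCast, ← zpow_natCast]
  exact zpow_eq_zpow_iff_modEq.2 (Int.modEq_iff_dvd.2 h3)

/-- `liftFun ζ u` may be computed at ANY level `N` with `u = (1/N)^m`: it equals `ζ_N ^ m`.
[cite: MochizukiAbsTopIII2015, Definition 3.1 (v) p.69] -/
theorem liftFun_eq (ζ : cyclotome A) {u : Multiplicative (AddCircle (1 : ℚ))} {N : ℕ+} {m : ℕ}
    (hu : u = (Multiplicative.ofAdd ((((1 : ℚ) / (N : ℕ) : ℚ) : AddCircle (1 : ℚ)))) ^ m) :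
    liftFun ζ u = (ζ : ℕ+ → A) N ^ m := by
  set n : ℕ+ := ordPNat u with hn
  set m₀ := (exists_eq_ofAdd_inv_pow (ordPNat u) (pow_ordPNat u)).choose with hm₀
  have hm₀' : u = (Multiplicative.ofAdd ((((1 : ℚ) / (n : ℕ) : ℚ) : AddCircle (1 : ℚ)))) ^ m₀ :=
    (exists_eq_ofAdd_inv_pow (ordPNat u) (pow_ordPNat u)).choose_spec
  change (ζ : ℕ+ → A) n ^ m₀ = (ζ : ℕ+ → A) N ^ m
  -- the order `n` of `u` divides `N` (as `u ^ N = 1`)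
  have huN : u ^ (N : ℕ) = 1 := by rw [hu, ← pow_mul, mul_comm, pow_mul, ofAdd_inv_pow_eq_one, one_pow]
  have hdvd : (n : ℕ) ∣ (N : ℕ) := orderOf_dvd_of_pow_eq_one huN
  obtain ⟨c, hc⟩ := hdvd
  have hcpos : 0 < c := Nat.pos_of_ne_zero (by rintro rfl; simp at hc)
  set c' : ℕ+ := ⟨c, hcpos⟩ with hc'
  have hNc : N = n * c' := PNat.coe_injective (by rw [PNat.mul_coe]; exact hc)
  -- rewrite `u` at level `N = n c`: `(1/n)^m₀ = (1/N)^(c m₀)`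
  have h1 : (Multiplicative.ofAdd ((((1 : ℚ) / (N : ℕ) : ℚ) : AddCircle (1 : ℚ)))) ^ ((c' : ℕ) * m₀) = u := by
    rw [pow_mul, hNc, ofAdd_inv_mul_pow, ← hm₀']
  have h2 := pow_eq_pow_of_ofAdd_inv_pow_eq ζ N (h1.trans hu)
  rw [← h2, pow_mul, hNc, pow_apply_mul]

/-- `liftFun` is multiplicative in `u`. [cite: MochizukiAbsTopIII2015, Definition 3.1 (v) p.69] -/
theorem liftFun_mul (ζ : cyclotome A) (u v : Multiplicative (AddCircle (1 : ℚ))) :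
    liftFun ζ (u * v) = liftFun ζ u * liftFun ζ v := by
  set N : ℕ+ := ordPNat u * ordPNat v with hN
  have hu : u ^ (N : ℕ) = 1 := by
    rw [hN, PNat.mul_coe, pow_mul, pow_ordPNat, one_pow]
  have hv : v ^ (N : ℕ) = 1 := by
    rw [hN, PNat.mul_coe, mul_comm, pow_mul, pow_ordPNat, one_pow]
  obtain ⟨a, ha⟩ := exists_eq_ofAdd_inv_pow N hu
  obtain ⟨b, hb⟩ := exists_eq_ofAdd_inv_pow N hv
  have hab : u * v = (Multiplicative.ofAdd ((((1 : ℚ) / (N : ℕ) : ℚ) : AddCircle (1 : ℚ)))) ^ (a + b) := by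
    rw [pow_add, ← ha, ← hb]
  rw [liftFun_eq ζ ha, liftFun_eq ζ hb, liftFun_eq ζ hab, pow_add]

/-- **`Λ(A) → Hom(ℚ/ℤ, A)`**: the homomorphism `u = (1/n)^m ↦ ζ_n^m` attached to `ζ ∈ Λ(A)`.
[cite: MochizukiAbsTopIII2015, Definition 3.1 (v) p.69] -/
noncomputable def toHom (ζ : cyclotome A) : Multiplicative (AddCircle (1 : ℚ)) →* A where
  toFun := liftFun ζ
  map_one' := by
    rw [liftFun_eq ζ (N := 1) (m := 0) (by rw [pow_zero]), pow_zero]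
  map_mul' := liftFun_mul ζ

/-- `toHom ζ (1/n) = ζ_n`. [cite: MochizukiAbsTopIII2015, Definition 3.1 (v) p.69] -/
@[simp] theorem toHom_ofAdd_inv (ζ : cyclotome A) (n : ℕ+) :
    toHom ζ (Multiplicative.ofAdd ((((1 : ℚ) / (n : ℕ) : ℚ) : AddCircle (1 : ℚ)))) = (ζ : ℕ+ → A) n := by
  change liftFun ζ _ = _
  rw [liftFun_eq ζ (N := n) (m := 1) (by rw [pow_one]), pow_one]

/-- `ofHom ∘ toHom = id`: `ofHom` is surjective. [cite: MochizukiAbsTopIII2015, Definition 3.1 (v) p.69] -/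
theorem ofHom_toHom (ζ : cyclotome A) : ofHom (toHom ζ) = ζ :=
  Subtype.ext (funext fun n => by rw [ofHom_apply_coe, toHom_ofAdd_inv])

/-- `ofHom` is surjective. [cite: MochizukiAbsTopIII2015, Definition 3.1 (v) p.69] -/
theorem ofHom_surjective : Surjective (ofHom (A := A)) := fun ζ => ⟨toHom ζ, ofHom_toHom ζ⟩

/-- **`Hom(ℚ/ℤ, A) ≅ Λ(A)`** — the canonical isomorphism «`μ_Ẑ := Hom(ℚ/ℤ, μ_{ℚ/ℤ})`» ↔ `lim_n (−)[n]`
([AbsTopIII] Def. 3.1 (v), Cor. 1.10 (i)(a); the comparison the tree's `muZhat` docstring defers to).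
[cite: MochizukiAbsTopIII2015, Definition 3.1 (v) p.69] -/
noncomputable def homQmodZEquiv : (Multiplicative (AddCircle (1 : ℚ)) →* A) ≃* cyclotome A :=
  MulEquiv.ofBijective ofHom ⟨ofHom_injective, ofHom_surjective⟩

/-- Components of `homQmodZEquiv φ`. [cite: MochizukiAbsTopIII2015, Definition 3.1 (v) p.69] -/
@[simp] theorem homQmodZEquiv_apply_coe (φ : Multiplicative (AddCircle (1 : ℚ)) →* A) (n : ℕ+) :
    ((homQmodZEquiv φ : cyclotome A) : ℕ+ → A) n =
      φ (Multiplicative.ofAdd ((((1 : ℚ) / (n : ℕ) : ℚ) : AddCircle (1 : ℚ)))) := rfl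

/-- The inverse of `homQmodZEquiv` is `toHom`. [cite: MochizukiAbsTopIII2015, Definition 3.1 (v) p.69] -/
theorem homQmodZEquiv_symm_apply (ζ : cyclotome A) : homQmodZEquiv.symm ζ = toHom ζ :=
  (MulEquiv.symm_apply_eq _).2 (ofHom_toHom ζ).symm

/-! ### Naturality and equivariance -/

/-- Naturality: `Λ(ψ) (ofHom φ) = ofHom (ψ ∘ φ)` for `ψ : A →* B`.
[cite: MochizukiAbsTopIII2015, Definition 3.1 (v) p.69] -/
theorem map_ofHom {B : Type*} [CommGroup B] (ψ : A →* B) (φ : Multiplicative (AddCircle (1 : ℚ)) →* A) :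
    map ψ (ofHom φ) = ofHom (ψ.comp φ) :=
  Subtype.ext (funext fun _ => rfl)

/-- Equivariance: for a group `G` acting on `A` by automorphisms, `ofHom (g ∘ φ) = g • ofHom φ` — so
`homQmodZEquiv` is an isomorphism of `G`-modules for the evident action `φ ↦ g ∘ φ` on `Hom(ℚ/ℤ, A)`.
[cite: MochizukiAbsTopIII2015, Definition 3.1 (v) p.69] -/
theorem ofHom_smul {G : Type*} [Group G] [MulDistribMulAction G A] (g : G)
    (φ : Multiplicative (AddCircle (1 : ℚ)) →* A) :
    ofHom ((MulDistribMulAction.toMonoidHom A g).comp φ) = g • ofHom φ :=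
  Subtype.ext (funext fun _ => rfl)

/-- Equivariance of the inverse: `toHom (g • ζ) = g ∘ toHom ζ`. [cite: MochizukiAbsTopIII2015, Definition 3.1 (v) p.69] -/
theorem toHom_smul {G : Type*} [Group G] [MulDistribMulAction G A] (g : G) (ζ : cyclotome A) :
    toHom (g • ζ) = (MulDistribMulAction.toMonoidHom A g).comp (toHom ζ) := by
  apply ofHom_injective
  rw [ofHom_toHom, ofHom_smul, ofHom_toHom]

end cyclotome

end Literature.AnabelianGeometry.EtaleTheta
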